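import Mathlib
import Literature.Analysis.Complex.HarnackHalfPlane
import Literature.Analysis.Complex.UnivalentSequenceLimits
import Summits.QuantumFields.QCD.Theses.EulerDescent

/-!
# Crux `RayDescent` (stmt-QuantumFields-16900), negative side — hidden content of the stub
`stub_harnackConeMembership` of line `Sketch`

Disprover record (route `EulerDescent`, sub-problem QCD; cdisprove seat, cycle 1), about the
load-bearing physics stub (M) `stub_harnackConeMembership` of the picked line `Sketch`
(`Cruxes/RayDescent/Lines/Sketch.lean`, skeleton 77369e41…; the mathematical stub (H), the sharp
half-plane Harnack chord `(x₁/x₂) v(x₂) ≤ v(x₁)`, is landed, p166243).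

Harnack's inequality on the half-plane is TWO-sided. Besides the chord the line uses (H: `v(x)/x`
non-increasing along the normal ray), every non-negative harmonic function on `{Re z > 0}` also has
`x·v(x)` NON-DECREASING along the ray (`harnackCone_reverseChord`, the upper Harnack bound
`(1+ρ)/(1−ρ) = x₂/x₁` under the same Cayley map; Conway, *Functions of One Complex Variable I*,
Ch. X §2). Both properties pass to infima of families, to `∀ᶠ k` and to `liminf_k`, so the conclusion
of stub (M) — "the volume-uniform gap along the ray `t·m` is `liminf_k inf_i G k i t` with every
`G k i` harmonic and non-negative on the right half-plane" — asserts, besides the crux's downward law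
`Δ(m) ≥ Δ(t·m)/t`, a SECOND physical law that the line never uses:

* `upwardLaw_of_harnackConeMembership` — (M) ⟹ for every regularisation pinned at the intrinsic
  corner with mass and asymptotic scaling and every positive tuple `m` in Lüscher's range: a uniform
  lattice gap `Δ` at `t₁·m` gives every rate `Δ' < (t₁/t₂)·Δ` at `t₂·m` for `1 ≤ t₁ ≤ t₂` — going UP a
  mass ray by the factor `s = t₂/t₁` loses at most the factor `1/s` ("sub-inverse upward law").

Reading: this hidden law is the weak shadow of mass-monotonicity UP (sibling crux
`QuarkMassMonotone.LatticeGapMonotone`, stmt-QuantumFields-8905: the gap is non-decreasing in the quark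
masses), so it is physically harmless — but it is CONTENT: stub (M) is not the minimal C⁺ of the
Harnack mechanism, it is "downward Euler law ∧ sub-inverse upward law ∧ Harnack-hull shape
conditions" (a function with `g(x)/x ↓` and `x g(x) ↑`, e.g. `max 1 (x/2)` on `[1, ∞)`, need not be
an infimum of non-negative harmonic functions on the half-plane). A refutation of (M) may therefore
come from either direction of the ray. Pure theorem file, tree vocabulary only (the stub's conclusion
is quoted verbatim as the hypothesis `hM`). [folklore]
-/

noncomputable section

namespace Summit.QuantumFields.QCD.Theorems.RayDescentNegative

open Complex Metric Set Filter Topology InnerProductSpace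
open Literature.MathematicalPhysics.QuantumFieldTheory

/-- The Cayley map `w ↦ (1 + w)/(1 - w)` sends the open unit disc into the right half-plane:
`re ((1 + w)/(1 - w)) = (1 - |w|²)/|1 - w|² > 0` for `|w| < 1`. [folklore] -/
private theorem re_cayley_pos {w : ℂ} (hw : ‖w‖ < 1) : 0 < ((1 + w) / (1 - w)).re := by
  have h1 : 1 - w ≠ 0 := by
    intro h
    have : ‖w‖ = 1 := by rw [sub_eq_zero] at h; rw [← h]; simp
    linarith
  have hns : 0 < normSq (1 - w) := normSq_pos.2 h1
  have hw2 : w.re ^ 2 + w.im ^ 2 < 1 := by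
    have h : ‖w‖ ^ 2 < 1 := by nlinarith [norm_nonneg w]
    rw [Complex.sq_norm, normSq_apply] at h
    nlinarith
  rw [div_re, ← add_div]
  refine div_pos ?_ hns
  simp only [add_re, one_re, sub_re, add_im, one_im, sub_im, zero_add, zero_sub]
  nlinarith

/-- **The reverse Harnack chord of the right half-plane**: a non-negative harmonic function `v` on
`{Re z > 0}` satisfies `x₁·v(x₁) ≤ x₂·v(x₂)` for `0 < x₁ ≤ x₂` — `x ↦ x·v(x)` is non-decreasing
along the normal ray (the UPPER Harnack bound of the disc, `u(w) ≤ u(0)(1+|w|)/(1−|w|)`, transported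
by the Cayley map `w ↦ x₂(1+w)/(1−w)`, under which `(1+|w|)/(1−|w|) = x₂/x₁` at `ψ(w) = x₁`;
Herglotz: `x v(x) = c x² + π⁻¹∫ x² dν(s)/(x² + s²)`). [cite: Conway1978, Ch. X §2] -/
theorem harnackCone_reverseChord :
    ∀ v : ℂ → ℝ, InnerProductSpace.HarmonicOnNhd v {z : ℂ | 0 < z.re} →
      (∀ z : ℂ, 0 < z.re → 0 ≤ v z) →
      ∀ x₁ x₂ : ℝ, 0 < x₁ → x₁ ≤ x₂ → x₁ * v x₁ ≤ x₂ * v x₂ := by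
  intro v hv hv0 x₁ x₂ hx₁ hx₁₂
  have hx₂ : 0 < x₂ := lt_of_lt_of_le hx₁ hx₁₂
  have hs : 0 < x₁ + x₂ := by positivity
  -- the Cayley map of the disc into the right half-plane, normalised by `ψ 0 = x₂`
  set ψ : ℂ → ℂ := fun w ↦ (x₂ : ℂ) * ((1 + w) / (1 - w)) with hψ
  have hne : ∀ w ∈ ball (0 : ℂ) 1, (1 : ℂ) - w ≠ 0 := by
    intro w hw h
    rw [mem_ball_zero_iff] at hw
    rw [sub_eq_zero] at h
    rw [← h] at hw
    simp at hw
  have hψd : DifferentiableOn ℂ ψ (ball 0 1) := by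
    intro w hw
    have h1 : DifferentiableAt ℂ (fun w : ℂ ↦ (1 + w) / (1 - w)) w :=
      ((differentiableAt_const _).add differentiableAt_id).div
        ((differentiableAt_const _).sub differentiableAt_id) (hne w hw)
    exact (h1.const_mul (x₂ : ℂ)).differentiableWithinAt
  have hψre : ∀ w ∈ ball (0 : ℂ) 1, 0 < (ψ w).re := by
    intro w hw
    show 0 < ((x₂ : ℂ) * ((1 + w) / (1 - w))).re
    rw [re_ofReal_mul]
    exact mul_pos hx₂ (re_cayley_pos (mem_ball_zero_iff.1 hw))
  have hmaps : MapsTo ψ (ball 0 1) {z : ℂ | 0 < z.re} := fun w hw ↦ hψre w hw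
  have hopen : IsOpen {z : ℂ | 0 < z.re} := isOpen_lt continuous_const Complex.continuous_re
  -- `v ∘ ψ` is harmonic on the disc, hence the real part of a holomorphic `F`
  have hu : HarmonicOnNhd (fun w ↦ v (ψ w)) (ball 0 1) :=
    Literature.Analysis.Complex.harmonicOnNhd_comp_of_differentiableOn hv hopen hψd isOpen_ball
      hmaps
  obtain ⟨F, hFa, hFre⟩ := hu.exists_analyticOnNhd_ball_re_eq
  -- the two points: `ψ 0 = x₂` and `ψ (-ρ) = x₁`, `ρ = (x₂ - x₁)/(x₁ + x₂) ∈ [0,1)`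
  set ρ : ℝ := (x₂ - x₁) / (x₁ + x₂) with hρ
  have hρ0 : 0 ≤ ρ := div_nonneg (by linarith) hs.le
  have hρ1 : ρ < 1 := by rw [hρ, div_lt_one hs]; linarith
  have h1ρ : 1 - ρ = 2 * x₁ / (x₁ + x₂) := by rw [hρ]; field_simp; ring
  have h1ρ' : 1 + ρ = 2 * x₂ / (x₁ + x₂) := by rw [hρ]; field_simp; ring
  have hquot : (1 + ρ) / (1 - ρ) = x₂ / x₁ := by
    rw [h1ρ, h1ρ']
    field_simp
  set w₁ : ℂ := ((-ρ : ℝ) : ℂ) with hw₁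
  have hw₁n : ‖w₁‖ = ρ := by
    rw [hw₁, norm_real, Real.norm_eq_abs, abs_neg, abs_of_nonneg hρ0]
  have hw₁b : w₁ ∈ ball (0 : ℂ) 1 := mem_ball_zero_iff.2 (by rw [hw₁n]; exact hρ1)
  have h0b : (0 : ℂ) ∈ ball (0 : ℂ) 1 := mem_ball_self one_pos
  have hψ0 : ψ 0 = (x₂ : ℂ) := by simp [hψ]
  have hψ1 : ψ w₁ = (x₁ : ℂ) := by
    have h1 : (1 : ℂ) + w₁ = ((2 * x₁ / (x₁ + x₂) : ℝ) : ℂ) := by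
      rw [← h1ρ, hw₁]; push_cast; ring
    have h2 : (1 : ℂ) - w₁ = ((2 * x₂ / (x₁ + x₂) : ℝ) : ℂ) := by
      rw [← h1ρ', hw₁]; push_cast; ring
    show (x₂ : ℂ) * ((1 + w₁) / (1 - w₁)) = (x₁ : ℂ)
    rw [h1, h2]
    norm_cast
    field_simp
  -- the UPPER Harnack inequality on the unit disc for `Q = (F + ε) I`, `im Q = v ∘ ψ + ε > 0`
  have hchord : ∀ ε : ℝ, 0 < ε → v x₁ + ε ≤ (v x₂ + ε) * ((1 + ρ) / (1 - ρ)) := by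
    intro ε hε
    set Q : ℂ → ℂ := fun w ↦ (F w + ε) * I with hQ
    have hQim : ∀ w ∈ ball (0 : ℂ) 1, (Q w).im = v (ψ w) + ε := by
      intro w hw
      have e : (F w).re = v (ψ w) := hFre hw
      show ((F w + ε) * I).im = v (ψ w) + ε
      rw [mul_I_im, add_re, ofReal_re, e]
    have hQd : DifferentiableOn ℂ Q (ball 0 1) :=
      (hFa.differentiableOn.add_const _).mul_const _
    have hQpos : ∀ w ∈ ball (0 : ℂ) 1, 0 < (Q w).im := by
      intro w hw
      rw [hQim w hw]
      exact add_pos_of_nonneg_of_pos (hv0 _ (hψre w hw)) hε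
    have h := Complex.im_apply_le_harnack one_pos hQd hQpos hw₁b
    rw [sub_zero, hw₁n, hQim 0 h0b, hQim w₁ hw₁b, hψ0, hψ1] at h
    exact h
  -- `ε → 0⁺`
  rw [hquot] at hchord
  refine le_of_forall_pos_le_add fun ε hε ↦ ?_
  have hε' : 0 < ε / x₂ := div_pos hε hx₂
  have h := hchord (ε / x₂) hε'
  -- multiply by `x₁ > 0`: `x₁ (v x₁ + ε/x₂) ≤ x₂ (v x₂ + ε/x₂) = x₂ v x₂ + ε`
  have h2 : x₁ * (v x₁ + ε / x₂) ≤ x₁ * ((v x₂ + ε / x₂) * (x₂ / x₁)) :=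
    mul_le_mul_of_nonneg_left h hx₁.le
  have h3 : x₁ * ((v x₂ + ε / x₂) * (x₂ / x₁)) = x₂ * v x₂ + ε := by
    field_simp
  have h4 : 0 ≤ x₁ * (ε / x₂) := by positivity
  nlinarith

/-- **Hidden upward law of stub (M).** If the conclusion of `stub_harnackConeMembership` holds for
a regularisation `reg` and a base tuple `m` (a family `G k i` of non-negative harmonic functions on
the right half-plane whose `liminf_k inf_i` along `[1, ∞)` is the volume-uniform gap of the ray
`t·m`: the stub's "upper" and "lower" clauses, quoted verbatim as `hupper`, `hlower`), then along
that ray a uniform lattice gap `Δ` at `t₁·m` yields every rate `Δ' < (t₁/t₂)·Δ` at `t₂·m` for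
`1 ≤ t₁ ≤ t₂`: by the reverse chord `t₁ G(t₁) ≤ t₂ G(t₂)`, so `G k i t₂ ≥ (t₁/t₂) Δ = Δ' + ε`
eventually, and the lower clause certifies `Δ'`. The line `Sketch` uses only the chord (H) at
`t = 1`; this second law rides along unused — stub (M) ⊢ a sub-inverse form of mass-monotonicity UP
the ray (cf. sibling crux `QuarkMassMonotone.LatticeGapMonotone`). [folklore] -/
theorem upwardLaw_of_harnackConeMembership {Nf : ℕ} (reg : QCDRegularisation Nf)
    (m : Fin Nf → ℝ) {ι : Type} (G : ℕ → ι → ℂ → ℝ)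
    (hharm : ∀ k i, InnerProductSpace.HarmonicOnNhd (G k i) {z : ℂ | 0 < z.re})
    (hnonneg : ∀ k i (z : ℂ), 0 < z.re → 0 ≤ G k i z)
    (hupper : ∀ t : ℝ, 1 ≤ t → ∀ Δ : ℝ, 0 < Δ →
      (reg.scheme (fun f => t * m f) 0 0).HasLatticeMassGap Δ → ∀ᶠ k in atTop, ∀ i, Δ ≤ G k i t)
    (hlower : ∀ t : ℝ, 1 ≤ t → ∀ Δ : ℝ, 0 < Δ →
      (∃ ε : ℝ, 0 < ε ∧ ∀ᶠ k in atTop, ∀ i, Δ + ε ≤ G k i t) →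
        (reg.scheme (fun f => t * m f) 0 0).HasLatticeMassGap Δ)
    (t₁ t₂ : ℝ) (ht₁ : 1 ≤ t₁) (ht₁₂ : t₁ ≤ t₂) (Δ : ℝ) (hΔ : 0 < Δ)
    (hgap : (reg.scheme (fun f => t₁ * m f) 0 0).HasLatticeMassGap Δ)
    (Δ' : ℝ) (hΔ' : 0 < Δ') (hlt : Δ' < t₁ * Δ / t₂) :
    (reg.scheme (fun f => t₂ * m f) 0 0).HasLatticeMassGap Δ' := by
  have ht₁0 : 0 < t₁ := lt_of_lt_of_le one_pos ht₁
  have ht₂0 : 0 < t₂ := lt_of_lt_of_le ht₁0 ht₁₂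
  have ht₂ : 1 ≤ t₂ := ht₁.trans ht₁₂
  -- upper clause at `t₁`, eventually in `k`
  have h1 : ∀ᶠ k in atTop, ∀ i, Δ ≤ G k i (t₁ : ℂ) := hupper t₁ ht₁ Δ hΔ hgap
  -- uniform slack at `t₂` from the reverse chord
  obtain ⟨ε, hε⟩ : ∃ ε : ℝ, ε = t₁ * Δ / t₂ - Δ' := ⟨_, rfl⟩
  have hεpos : 0 < ε := by rw [hε]; linarith
  have h3 : ∀ᶠ k in atTop, ∀ i, Δ' + ε ≤ G k i (t₂ : ℂ) := by
    filter_upwards [h1] with k hk i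
    have h2 : t₁ * G k i (t₁ : ℂ) ≤ t₂ * G k i (t₂ : ℂ) :=
      harnackCone_reverseChord (G k i) (hharm k i) (hnonneg k i) t₁ t₂ ht₁0 ht₁₂
    have ha : t₁ * Δ ≤ t₁ * G k i (t₁ : ℂ) := mul_le_mul_of_nonneg_left (hk i) ht₁0.le
    have hb : t₁ * Δ / t₂ ≤ G k i (t₂ : ℂ) := by
      rw [div_le_iff₀ ht₂0]
      nlinarith
    calc Δ' + ε = t₁ * Δ / t₂ := by rw [hε]; ring
      _ ≤ G k i (t₂ : ℂ) := hb
  exact hlower t₂ ht₂ Δ' hΔ' ⟨ε, hεpos, h3⟩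

/-- **Stub (M) implies the sub-inverse upward law along every admissible ray** (the stub's full
signature quoted verbatim as the hypothesis `hM`; conclusion: for every `N_f`, every regularisation
pinned at the intrinsic corner with mass and asymptotic scaling, every positive tuple in Lüscher's
range, `1 ≤ t₁ ≤ t₂`, a uniform gap `Δ` at `t₁·m` gives every `Δ' < (t₁/t₂)Δ` at `t₂·m`). [folklore] -/
theorem stub_harnackConeMembership_upwardLaw
    (hM : ∀ (Nf : ℕ) (reg : QCDRegularisation Nf),
      (∀ᶠ k in atTop, IsLUB {μ : ℝ | ¬ (∀ (R R' : ℕ) (A : QCDLatticeObservable Nf R)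
          (B : QCDLatticeObservable Nf R'), ∃ (C δ : ℝ) (S₀ : ℕ), 0 < δ ∧ ∀ S : ℕ, S₀ ≤ S →
            ∀ n : ℕ, n ≤ S → ‖qcdLatticeConnectedCorr (reg.β k) (2 * S + 1) (fun _ : Fin Nf => μ)
              A B n‖ ≤ C * Real.exp (-(δ * n)))} (reg.mcrit k)) →
      reg.HasMassScaling → (reg.scheme 0 0 0).HasAsymptoticScaling →
      ∀ m : Fin Nf → ℝ, (∀ f, 0 < m f) →
        (∀ᶠ k in atTop, ∀ f, (-1 : ℝ) < reg.mcrit k + reg.a k * m f / reg.Zm k) →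
        ∃ (ι : Type) (G : ℕ → ι → ℂ → ℝ),
          (∀ k i, InnerProductSpace.HarmonicOnNhd (G k i) {z : ℂ | 0 < z.re}) ∧
          (∀ k i (z : ℂ), 0 < z.re → 0 ≤ G k i z) ∧
          (∀ t : ℝ, 1 ≤ t → ∀ Δ : ℝ, 0 < Δ →
            (reg.scheme (fun f => t * m f) 0 0).HasLatticeMassGap Δ →
              ∀ᶠ k in atTop, ∀ i, Δ ≤ G k i t) ∧
          (∀ t : ℝ, 1 ≤ t → ∀ Δ : ℝ, 0 < Δ →
            (∃ ε : ℝ, 0 < ε ∧ ∀ᶠ k in atTop, ∀ i, Δ + ε ≤ G k i t) →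
              (reg.scheme (fun f => t * m f) 0 0).HasLatticeMassGap Δ))
    (Nf : ℕ) (reg : QCDRegularisation Nf)
    (hcorner : ∀ᶠ k in atTop, IsLUB {μ : ℝ | ¬ (∀ (R R' : ℕ) (A : QCDLatticeObservable Nf R)
        (B : QCDLatticeObservable Nf R'), ∃ (C δ : ℝ) (S₀ : ℕ), 0 < δ ∧ ∀ S : ℕ, S₀ ≤ S →
          ∀ n : ℕ, n ≤ S → ‖qcdLatticeConnectedCorr (reg.β k) (2 * S + 1) (fun _ : Fin Nf => μ)
            A B n‖ ≤ C * Real.exp (-(δ * n)))} (reg.mcrit k))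
    (hms : reg.HasMassScaling) (haf : (reg.scheme 0 0 0).HasAsymptoticScaling)
    (m : Fin Nf → ℝ) (hm : ∀ f, 0 < m f)
    (hrange : ∀ᶠ k in atTop, ∀ f, (-1 : ℝ) < reg.mcrit k + reg.a k * m f / reg.Zm k)
    (t₁ t₂ : ℝ) (ht₁ : 1 ≤ t₁) (ht₁₂ : t₁ ≤ t₂) (Δ : ℝ) (hΔ : 0 < Δ)
    (hgap : (reg.scheme (fun f => t₁ * m f) 0 0).HasLatticeMassGap Δ)
    (Δ' : ℝ) (hΔ' : 0 < Δ') (hlt : Δ' < t₁ * Δ / t₂) :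
    (reg.scheme (fun f => t₂ * m f) 0 0).HasLatticeMassGap Δ' := by
  obtain ⟨ι, G, hharm, hnonneg, hupper, hlower⟩ := hM Nf reg hcorner hms haf m hm hrange
  exact upwardLaw_of_harnackConeMembership reg m G hharm hnonneg hupper hlower t₁ t₂ ht₁ ht₁₂ Δ hΔ
    hgap Δ' hΔ' hlt

end Summit.QuantumFields.QCD.Theorems.RayDescentNegative

end
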